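import Summits.Ventures.Crystal3D.Theorems.StickyWulffConstantPolycrystalWulffBoundCoherentTwinCells
import Summits.Ventures.Crystal3D.Theorems.StickyWulffConstantTextureLiminfPolytopeCalculus
import Summits.Ventures.Crystal3D.Theorems.StickyWulffConstantPolycrystalWulffBoundFacetAreaSymm
import Summits.Ventures.Crystal3D.Theorems.StickyWulffConstantPolycrystalWulffBoundSeparated
import Literature.Analysis.Convexity.AnisotropicPerimeterTransform
import Literature.Analysis.Convexity.AnisotropicPerimeterSelf

/-!
# `PolycrystalWulffBound`: the COHERENT CENTRAL TWIN is an EXACT EQUALITY CASE of the two-grain twin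
# inequality — `F(E₀) = 96 = 6·2^{1/3}(√2·|E₀|)^{2/3}`, `|E₀| = 32` (cubic frame)
# (crux `stmt-Ventures-19482` / `23911`; memo P-TWIN-g16 §2; cf-p1 (lxxvi)(2) «E₀ equality BY NAME»)

Route `StickyWulffConstant` of the venture `Summits/Ventures/Crystal3D`, second prover lane (poly-p2,
gen 16).  `E₀ = T ∪ R T` with `T = polytope topHalfHRep` (the open upper half of the cubic Wulff body
`W = fccWulffBody` along its hexagonal axis `m = twinAxis`) and `R` the reflection in `m^⊥`; phase 1
(body `W`) on `T`, phase 2 (body `R '' W`) on `R T`; twin wall kernel `Dsc m = {‖y‖ ≤ 1, ⟪y,m⟫ = 0}`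
at charge `½`.  In the route's `per`/`ι` vocabulary (`per K S = (P_K(S)).toReal`, `ι_K(A,B) =
(per K A + per K B − per K (A ∪ B))/2`):

  `(per W T − ι_W(T, RT)) + (per (R W) (RT) − ι_{RW}(RT, T)) + ½·ι_{Dsc m}(T, RT) = 96`,
  `|T ∪ RT| = 32`, `6·2^{1/3}(√2·32)^{2/3} = 96`.

PROOF (facet calculus of `stub_polytopeCalculus`, no facet area is ever evaluated): clause (B) for the
pair `(T, RT)` with separating normal `m` gives `ι_K(T,RT) = ½(h_K(m) + h_K(−m))·fA` with `fA` the
prism-area of the common hexagon, i.e. `√3·fA` for `K = W` and `0` for `K = Dsc m`; clause (A) for `T`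
with `K = W` and with `K = closure T` (whose support values agree with the levels on every constraint
of `W` that carries area, and vanish on the cut) gives `per W T = per (cl T) T + √3·fA = 3|T| + √3·fA`
(`P_K(K) = 3|K|`, `anisotropicPerimeter_self`); the `R W` terms equal the `W` terms by isometry
invariance; `|T| = 16`.  Hence `F = 2(48 + √3 fA) − 2√3 fA + 0 = 96`.  So every proof of the two-grain
inequality must be TIGHT on a genuine two-phase texture; stability / superadditivity strategies are void.
WHAT THIS IS NOT: the two-grain inequality; a statement about the crux's lattice frames (transport to
`W(A)` by the isometry `L.trans A` is immediate but not done here); the crux is not claimed.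
-/

noncomputable section

open scoped BigOperators InnerProductSpace ENNReal
open MeasureTheory Set

namespace Summit.Ventures.Crystal3D.Theorems

open Summit.Ventures.Crystal3D.Cruxes.TextureLiminf.TexShadow (E3 polytope supportFn facetArea per perK
  PolytopeCalculus stub_polytopeCalculus perK_eq_anisotropicPerimeter)

open Literature.MathematicalPhysics.StatisticalMechanics (fccWulffBody mem_fccWulffBody_iff
  isCompact_fccWulffBody volume_fccWulffBody convex_fccWulffBody zero_mem_fccWulffBody)

open Literature.Analysis.Convexity (anisotropicPerimeter anisotropicPerimeter_image_linearIsometryEquiv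
  anisotropicPerimeter_closure_eq_of_convex anisotropicPerimeter_self)

/-! ### Isometry invariance of `per` under the mirror -/

/-- `per (g K) (g S) = per K S` for a linear isometry `g`. -/
theorem per_image_linearIsometryEquiv (g : E3 ≃ₗᵢ[ℝ] E3) (K S : Set E3) :
    per (g '' K) (g '' S) = per K S := by
  unfold per
  rw [perK_eq_anisotropicPerimeter, perK_eq_anisotropicPerimeter,
    anisotropicPerimeter_image_linearIsometryEquiv]

/-- `R (R S) = S`. -/
theorem reflection_image_image (S : Set E3) :
    (ℝ ∙ twinAxis)ᗮ.reflection '' ((ℝ ∙ twinAxis)ᗮ.reflection '' S) = S := by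
  rw [Set.image_image]
  simp [Submodule.reflection_reflection]

/-! ### `facetArea ∅ = 0` -/

/-- The prism over the empty set is empty. -/
theorem facetArea_empty (ν : E3) : facetArea (∅ : Set E3) ν = 0 := by
  unfold facetArea
  have : {x : E3 | ∃ y ∈ (∅ : Set E3), ∃ t ∈ Set.Icc (0 : ℝ) 1, x = y + t • ν} = ∅ := by
    ext x; simp
  rw [this, measure_empty, ENNReal.toReal_zero]

/-! ### Support values of the wall disc and of `closure T` -/

/-- `h_{Dsc m}(±m) = 0`: the wall disc is orthogonal to the axis. -/
theorem supportFn_cruxDisc_axis (v : E3) (hv : v = twinAxis ∨ v = -twinAxis) :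
    supportFn {y : E3 | ‖y‖ ≤ 1 ∧ ⟪y, twinAxis⟫_ℝ = 0} v = 0 := by
  unfold supportFn
  have himg : (fun y : E3 => ⟪y, v⟫_ℝ) '' {y : E3 | ‖y‖ ≤ 1 ∧ ⟪y, twinAxis⟫_ℝ = 0} = {0} := by
    ext r
    simp only [mem_image, mem_setOf_eq, mem_singleton_iff]
    constructor
    · rintro ⟨y, ⟨-, hy⟩, rfl⟩
      rcases hv with rfl | rfl
      · exact hy
      · rw [inner_neg_right, hy, neg_zero]
    · rintro rfl
      exact ⟨0, ⟨by simp, by simp⟩, by simp⟩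
  rw [himg, csSup_singleton]

/-- `h_{cl T}(−m) = 0`: the closed upper half lies in `{⟪m,x⟫ ≥ 0}` and contains `0`. -/
theorem supportFn_closure_topHalf_neg_twinAxis :
    supportFn (closure (polytope topHalfHRep)) (-twinAxis) = 0 := by
  unfold supportFn
  refine IsGreatest.csSup_eq ⟨⟨0, zero_mem_closure_topHalf, by simp⟩, ?_⟩
  rintro _ ⟨y, hy, rfl⟩
  have h := closure_topHalf_subset_halfspace hy
  simp only [mem_setOf_eq] at h
  show ⟪y, -twinAxis⟫_ℝ ≤ 0
  rw [inner_neg_right, real_inner_comm]; linarith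

/-- On every constraint `q` of `W` whose facet meets `closure T`, the support value of `closure T` is the
level `q.2`. -/
theorem supportFn_closure_topHalf_eq {q : E3 × ℝ} (hq : q ∈ wulffHRep)
    (hne : (closure (polytope topHalfHRep) ∩ {x : E3 | ⟪q.1, x⟫_ℝ = q.2}).Nonempty) :
    supportFn (closure (polytope topHalfHRep)) q.1 = q.2 := by
  obtain ⟨y, hy, hyq⟩ := hne
  unfold supportFn
  refine IsGreatest.csSup_eq ⟨⟨y, hy, by show ⟪y, q.1⟫_ℝ = q.2; rw [real_inner_comm]; exact hyq⟩, ?_⟩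
  rintro _ ⟨z, hz, rfl⟩
  have hzW : z ∈ fccWulffBody := closure_topHalf_subset_fccWulffBody hz
  rw [fccWulffBody_eq_closedHPolytope] at hzW
  show ⟪z, q.1⟫_ℝ ≤ q.2
  rw [real_inner_comm]; exact hzW q hq

/-! ### Clause (A): the facet sums of `T` for `K = W` and `K = closure T` -/

/-- `per W T = h_W(−m)·fa_cut + Σ_{q ∈ wulffHRep} q.2 · fa_q`. -/
theorem per_fccWulffBody_topHalf :
    per fccWulffBody (polytope topHalfHRep) =
      Real.sqrt 3 * facetArea (closure (polytope topHalfHRep) ∩ {x : E3 | ⟪-twinAxis, x⟫_ℝ = 0}) (-twinAxis) +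
      ∑ q ∈ wulffHRep, q.2 * facetArea (closure (polytope topHalfHRep) ∩ {x : E3 | ⟪q.1, x⟫_ℝ = q.2}) q.1 := by
  obtain ⟨hA, -⟩ := stub_polytopeCalculus fccWulffBody isCompact_fccWulffBody convex_fccWulffBody
    zero_mem_fccWulffBody
  rw [hA topHalfHRep isBounded_polytope_topHalfHRep topHalfHRep_norm_eq_one topHalfHRep_planes_ne,
    topHalfHRep, Finset.sum_insert neg_twinAxis_zero_notMem]
  congr 1
  · rw [supportFn_fccWulffBody_twinAxis.2]
  · exact Finset.sum_congr rfl fun q hq => by rw [supportFn_fccWulffBody_eq q hq]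

/-- `per (cl T) T = Σ_{q ∈ wulffHRep} q.2 · fa_q` (the cut carries support value `0`; the untouched
facets of `W` carry no area). -/
theorem per_closure_topHalf :
    per (closure (polytope topHalfHRep)) (polytope topHalfHRep) =
      ∑ q ∈ wulffHRep, q.2 * facetArea (closure (polytope topHalfHRep) ∩ {x : E3 | ⟪q.1, x⟫_ℝ = q.2}) q.1 := by
  have hconv : Convex ℝ (closure (polytope topHalfHRep)) := (convex_polytope _).closure
  obtain ⟨hA, -⟩ := stub_polytopeCalculus (closure (polytope topHalfHRep)) isCompact_closure_topHalf hconv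
    zero_mem_closure_topHalf
  rw [hA topHalfHRep isBounded_polytope_topHalfHRep topHalfHRep_norm_eq_one topHalfHRep_planes_ne,
    topHalfHRep, Finset.sum_insert neg_twinAxis_zero_notMem]
  have hcut : supportFn (closure (polytope (insert (-twinAxis, (0:ℝ)) wulffHRep))) (-twinAxis, (0:ℝ)).1 = 0 :=
    supportFn_closure_topHalf_neg_twinAxis
  rw [hcut, zero_mul, zero_add]
  refine Finset.sum_congr rfl fun q hq => ?_
  by_cases hne : (closure (polytope topHalfHRep) ∩ {x : E3 | ⟪q.1, x⟫_ℝ = q.2}).Nonempty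
  · rw [show polytope (insert (-twinAxis, (0:ℝ)) wulffHRep) = polytope topHalfHRep from rfl,
      supportFn_closure_topHalf_eq hq hne]
  · rw [Set.not_nonempty_iff_eq_empty] at hne
    rw [show polytope (insert (-twinAxis, (0:ℝ)) wulffHRep) = polytope topHalfHRep from rfl, hne,
      facetArea_empty, mul_zero, mul_zero]

/-- `per (cl T) T = 3|T| = 48`. -/
theorem per_closure_topHalf_eq : per (closure (polytope topHalfHRep)) (polytope topHalfHRep) = 48 := by
  have hconv : Convex ℝ (polytope topHalfHRep) := convex_polytope _
  unfold per
  rw [perK_eq_anisotropicPerimeter, ← anisotropicPerimeter_closure_eq_of_convex _ hconv,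
    anisotropicPerimeter_self (by norm_num) isCompact_closure_topHalf hconv.closure zero_mem_closure_topHalf,
    (Literature.Analysis.Convexity.volume_closure_eq_of_convex hconv).1, volume_polytope_topHalfHRep,
    ENNReal.toReal_mul, ENNReal.toReal_ofReal (by norm_num)]
  norm_num

/-- `per W T = 48 + √3 · fa_cut`. -/
theorem per_fccWulffBody_topHalf_eq :
    per fccWulffBody (polytope topHalfHRep) = 48 +
      Real.sqrt 3 * facetArea (closure (polytope topHalfHRep) ∩ {x : E3 | ⟪-twinAxis, x⟫_ℝ = 0}) (-twinAxis) := by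
  rw [per_fccWulffBody_topHalf, ← per_closure_topHalf, per_closure_topHalf_eq, add_comm]

/-! ### Clause (B): the interface of the pair `(T, R T)` -/

/-- Clause (B) for the two cells: `per K (T ∪ RT) = per K T + per K (RT) − (h_K(m) + h_K(−m))·fA`. -/
theorem per_union_coherentTwin {K : Set E3} (hK : IsCompact K) (hKc : Convex ℝ K) (hK0 : (0 : E3) ∈ K) :
    per K (polytope topHalfHRep ∪ (ℝ ∙ twinAxis)ᗮ.reflection '' polytope topHalfHRep) =
      per K (polytope topHalfHRep) + per K ((ℝ ∙ twinAxis)ᗮ.reflection '' polytope topHalfHRep) -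
        (supportFn K twinAxis + supportFn K (-twinAxis)) *
          facetArea (closure (polytope topHalfHRep) ∩
            closure ((ℝ ∙ twinAxis)ᗮ.reflection '' polytope topHalfHRep)) twinAxis := by
  obtain ⟨-, hB⟩ := stub_polytopeCalculus K hK hKc hK0
  set H : Fin 2 → Finset (E3 × ℝ) := ![topHalfHRep, botHalfHRep] with hH
  have hH0 : polytope (H 0) = polytope topHalfHRep := by simp [hH]
  have hH1 : polytope (H 1) = (ℝ ∙ twinAxis)ᗮ.reflection '' polytope topHalfHRep := by
    simp [hH, polytope_botHalfHRep_eq]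
  have hbd : ∀ i, Bornology.IsBounded (polytope (H i)) := by
    refine Fin.forall_fin_two.2 ⟨?_, ?_⟩
    · rw [hH0]; exact isBounded_polytope_topHalfHRep
    · rw [hH1]
      exact ((ℝ ∙ twinAxis)ᗮ.reflection.lipschitz.isBounded_image isBounded_polytope_topHalfHRep)
  have hdisj : ∀ i j, i ≠ j → Disjoint (polytope (H i)) (polytope (H j)) := by
    refine Fin.forall_fin_two.2 ⟨Fin.forall_fin_two.2 ⟨fun h => absurd rfl h, fun _ => ?_⟩,
      Fin.forall_fin_two.2 ⟨fun _ => ?_, fun h => absurd rfl h⟩⟩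
    · rw [hH0, hH1]; exact disjoint_topHalf_reflection
    · rw [hH0, hH1]; exact disjoint_topHalf_reflection.symm
  have hν : ∀ i j, i ≠ j → ‖twinAxis‖ = 1 ∧ ∃ b : ℝ,
      closure (polytope (H i)) ∩ closure (polytope (H j)) ⊆ {x : E3 | ⟪twinAxis, x⟫_ℝ = b} := by
    refine Fin.forall_fin_two.2 ⟨Fin.forall_fin_two.2 ⟨fun h => absurd rfl h, fun _ => ⟨norm_twinAxis, 0, ?_⟩⟩,
      Fin.forall_fin_two.2 ⟨fun _ => ⟨norm_twinAxis, 0, ?_⟩, fun h => absurd rfl h⟩⟩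
    · rw [hH0, hH1]; exact closure_inter_closure_subset_plane
    · rw [hH0, hH1, inter_comm]; exact closure_inter_closure_subset_plane
  have h := hB 2 H (fun _ _ => twinAxis) hbd hdisj hν
  have hU : (⋃ i, polytope (H i)) = polytope topHalfHRep ∪ (ℝ ∙ twinAxis)ᗮ.reflection '' polytope topHalfHRep := by
    ext x
    simp only [mem_iUnion, mem_union, Fin.exists_fin_two, hH0, hH1]
  rw [hU] at h
  have h10 : ¬ ((1 : Fin 2) < 0) := by decide
  have h01 : ((0 : Fin 2) < 1) := by decide
  simp only [Fin.sum_univ_two, hH0, hH1, lt_self_iff_false, if_false, h01, if_true, h10, add_zero,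
    zero_add] at h
  rw [h]

/-! ### The equality `F(E₀) = 96` -/

/-- **`F(E₀) = 96`: the coherent central twin attains the two-grain bound exactly.** -/
theorem coherentTwin_energy_eq :
    let W : Set E3 := fccWulffBody
    let R : E3 ≃ₗᵢ[ℝ] E3 := (ℝ ∙ twinAxis)ᗮ.reflection
    let T : Set E3 := polytope topHalfHRep
    let ι : Set E3 → Set E3 → Set E3 → ℝ := fun K A B => (per K A + per K B - per K (A ∪ B)) / 2
    (per W T - ι W T (R '' T)) + (per (R '' W) (R '' T) - ι (R '' W) (R '' T) T) +
      1 / 2 * ι {y : E3 | ‖y‖ ≤ 1 ∧ ⟪y, twinAxis⟫_ℝ = 0} T (R '' T) = 96 := by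
  intro W R T ι
  -- the disc kernel
  have hDc : IsCompact {y : E3 | ‖y‖ ≤ 1 ∧ ⟪y, twinAxis⟫_ℝ = 0} :=
    Metric.isCompact_of_isClosed_isBounded
      ((isClosed_le continuous_norm continuous_const).inter
        (isClosed_eq (continuous_id.inner continuous_const) continuous_const))
      (Metric.isBounded_closedBall.subset (cruxDisc_subset_closedBall twinAxis))
  have hDv : Convex ℝ {y : E3 | ‖y‖ ≤ 1 ∧ ⟪y, twinAxis⟫_ℝ = 0} := convex_cruxDisc twinAxis
  have hD0 : (0 : E3) ∈ {y : E3 | ‖y‖ ≤ 1 ∧ ⟪y, twinAxis⟫_ℝ = 0} := zero_mem_cruxDisc twinAxis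
  -- the common facet area
  set fA : ℝ := facetArea (closure T ∩ closure (R '' T)) twinAxis with hfA
  -- interface terms
  have hιW : ι W T (R '' T) = Real.sqrt 3 * fA := by
    show (per W T + per W (R '' T) - per W (T ∪ R '' T)) / 2 = _
    rw [per_union_coherentTwin isCompact_fccWulffBody convex_fccWulffBody zero_mem_fccWulffBody,
      supportFn_fccWulffBody_twinAxis.1, supportFn_fccWulffBody_twinAxis.2]
    ring
  have hιD : ι {y : E3 | ‖y‖ ≤ 1 ∧ ⟪y, twinAxis⟫_ℝ = 0} T (R '' T) = 0 := by
    show (per _ T + per _ (R '' T) - per _ (T ∪ R '' T)) / 2 = _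
    rw [per_union_coherentTwin hDc hDv hD0, supportFn_cruxDisc_axis _ (Or.inl rfl),
      supportFn_cruxDisc_axis _ (Or.inr rfl)]
    ring
  -- the mirror terms
  have hRT : R '' (R '' T) = T := reflection_image_image T
  have h1 : per (R '' W) (R '' T) = per W T := per_image_linearIsometryEquiv R W T
  have h2 : per (R '' W) T = per W (R '' T) := by
    conv_lhs => rw [← hRT]
    exact per_image_linearIsometryEquiv R W (R '' T)
  have h3 : per (R '' W) (R '' T ∪ T) = per W (T ∪ R '' T) := by
    have : R '' T ∪ T = R '' (T ∪ R '' T) := by rw [Set.image_union, hRT, union_comm]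
    rw [this]; exact per_image_linearIsometryEquiv R W _
  have hιW' : ι (R '' W) (R '' T) T = Real.sqrt 3 * fA := by
    show (per (R '' W) (R '' T) + per (R '' W) T - per (R '' W) (R '' T ∪ T)) / 2 = _
    rw [h1, h2, h3, ← hιW]
  -- the free energy of the upper half
  have hcut : facetArea (closure T ∩ {x : E3 | ⟪-twinAxis, x⟫_ℝ = 0}) (-twinAxis) = fA := by
    rw [hfA, facetArea_neg, ← closure_inter_closure_eq]
  have hperT : per W T = 48 + Real.sqrt 3 * fA := by
    rw [← hcut]; exact per_fccWulffBody_topHalf_eq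
  rw [hιW, hιW', hιD, h1, hperT]
  ring

/-- **`|E₀| = 32` and the bound: `6·2^{1/3}(√2·|E₀|)^{2/3} = 96`.** -/
theorem coherentTwin_bound_eq :
    6 * (2 : ℝ) ^ ((1 : ℝ) / 3) * (Real.sqrt 2 *
      (volume (polytope topHalfHRep ∪ (ℝ ∙ twinAxis)ᗮ.reflection '' polytope topHalfHRep)).toReal) ^ ((2 : ℝ) / 3)
      = 96 := by
  rw [volume_coherentTwin, ENNReal.toReal_ofReal (by norm_num)]
  have h := wulff_constant_smul (r := 1) one_pos
  norm_num at h
  exact h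

end Summit.Ventures.Crystal3D.Theorems

end
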